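import Mathlib
import Literature.Analysis.FluidPDE.VectorCalculus
import HarnessLib

/-!
# LINEAR FAMILIES OF KILLING FIELDS OF `ℝ³` WHOSE MEMBERS ALL HAVE A ZERO HAVE A COMMON ZERO
# (crux `EulerZoomLiouville.PowerGaugeEulerLiouville` = stmt-NavierStokesRegularity-19832; «E(3)-steady, escaping» stratum, step (v): the
# symmetry bookkeeping; width seat ns-ezl-w3 g6)

Route №10 `EulerZoomLiouville`, crux E.  The two-time identity of a rigid-frame-steady member (`RigidFrame.bodyFrame_twoTime`, ns-ezl-w3 g5)
puts every DIFFERENCE of body velocities `κ = (A(τ₁) − A(τ₂), v(τ₁) − v(τ₂))` — a Killing field `κ(w) = Bw + b`, `B` skew — into the linear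
space of Killing fields along which the Lie derivative of the profile is weakly a gradient; by `RigidFrame.killing_invariance` the profile is
invariant under the rigid motions generated by each such `κ`, and by `RigidFrame.screwInvariant_ae_eq_zero` it VANISHES as soon as one such
`κ` is a genuine screw or translation (no zero).  What is left is a LINEAR SPACE `W` of Killing fields EACH OF WHICH HAS A ZERO (is an
infinitesimal rotation about some axis, or `0`).  This file proves the elementary geometry that finishes the bookkeeping:

* `RigidFrame.skew_apply_eq_cross` — the hat map: a skew map of `ℝ³` is `x ↦ ω × x` with `ω = ((Be₁)₂, (Be₂)₀, (Be₀)₁)`, an expression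
  LINEAR in `B`;
* `RigidFrame.exists_skew_extension` — linear maps `Ω, β : W → ℝ³` with `⟪Ω w, β w⟫ = 0` and `ker Ω ≤ ker β` factor through a SKEW map:
  `β = M ∘ Ω`, `⟪Mx, x⟫ = 0` (`M = S − S^⊤(1 − P)` with `P` the orthogonal projection onto `range Ω` and `S = β ∘ Ω⁻¹ ∘ P`);
* `RigidFrame.exists_common_zero` — **if every member `(B, b)` of a linear subspace `W` of (skew map) × (vector) has `b ∈ range B`, then there is
  ONE point `p` with `b = Bp` for all `(B, b) ∈ W`**, i.e. the Killing fields `x ↦ B(x − p) ` all vanish at `p` (geometrically: the span of two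
  infinitesimal rotations is pitch-free iff the axes are coplanar, and three pairwise-meeting non-concurrent axes span a translation; the
  proof here is the coordinate-free version via the skew extension and the hat map).

Consequence used in the stratum file: the body velocities `(A(τ), v(τ)) = (R⁻¹R′, R⁻¹ξ′)` of a surviving rigid-frame-steady member have all
their differences vanishing at one point `p₀`, i.e. `v(τ) + A(τ)p₀ ≡ const`, so the lab point `ξ(τ) + R(τ)p₀` moves with SPEED OF CONSTANT NORM —
the centre grows at most linearly and the confined theorem `RigidFrame.ae_eq_zero_of_gauge_of_pastRigidFrameSteady_confined` (`β = 1`) applies.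

WHAT THIS IS NOT: not NS regularity, not the crux E — linear algebra for one symmetry stratum of the crux CLASS 19832 (MODEL lattice; E/NS
strata), `--supports` stmt-19832; 19832 OPEN. [folklore]
-/

noncomputable section

-- flat `Theorems/<Route><Decl>…` files of one crux share the namespace of the crux (tree convention: `Summit.<S>.<S>.…`)
set_option linter.dupNamespace false

open InnerProductSpace
open scoped RealInnerProductSpace Matrix

namespace Summit.NavierStokesRegularity.NavierStokesRegularity.Theorems.PowerGaugeEulerLiouville

namespace RigidFrame

open Literature.Analysis.FluidPDE

/-! ### Cross-product bookkeeping -/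

/-- `a × b = b × (−a)`. [folklore] -/
theorem cross_eq_cross_neg_swap (a b : EuclideanSpace ℝ (Fin 3)) : cross a b = cross b (-a) := by
  ext i
  fin_cases i <;> simp [cross, cross_apply] <;> ring

/-! ### The hat map -/

/-- **A skew map of `ℝ³` is a cross product, linearly in the map**: if `⟪Bx, x⟫ = 0` for all `x` then `Bx = ω_B × x` with
`ω_B = ((Be₁)₂, (Be₂)₀, (Be₀)₁)` (the three free entries of the antisymmetric matrix of `B`). [folklore] -/
theorem skew_apply_eq_cross {B : EuclideanSpace ℝ (Fin 3) →L[ℝ] EuclideanSpace ℝ (Fin 3)}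
    (hB : ∀ x, ⟪B x, x⟫ = 0) (x : EuclideanSpace ℝ (Fin 3)) :
    B x = cross (WithLp.toLp 2 ![B (EuclideanSpace.single 1 1) 2, B (EuclideanSpace.single 2 1) 0,
      B (EuclideanSpace.single 0 1) 1]) x := by
  -- adapted from the tree's `SymmetricLiouvilleScrewIsPeriodic.skew_apply_eq`
  have hpol : ∀ x y : EuclideanSpace ℝ (Fin 3), ⟪B x, y⟫ = -⟪B y, x⟫ := by
    intro x y
    have h := hB (x + y)
    rw [map_add, inner_add_left, inner_add_right, inner_add_right, hB x, hB y] at h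
    linarith
  have hent : ∀ i j : Fin 3, B (EuclideanSpace.single j 1) i = -B (EuclideanSpace.single i 1) j := by
    intro i j
    have h := hpol (EuclideanSpace.single j 1) (EuclideanSpace.single i 1)
    simpa [EuclideanSpace.inner_single_right] using h
  have hdiag : ∀ i : Fin 3, B (EuclideanSpace.single i 1) i = 0 := by
    intro i
    have h := hB (EuclideanSpace.single i 1)
    simpa [EuclideanSpace.inner_single_right] using h
  have hexp : B x = x 0 • B (EuclideanSpace.single 0 1) + x 1 • B (EuclideanSpace.single 1 1) +
      x 2 • B (EuclideanSpace.single 2 1) := by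
    have hx : x = x 0 • EuclideanSpace.single 0 (1 : ℝ) + x 1 • EuclideanSpace.single 1 (1 : ℝ) +
        x 2 • EuclideanSpace.single 2 (1 : ℝ) := by
      ext i; fin_cases i <;> simp
    calc B x = B (x 0 • EuclideanSpace.single 0 (1 : ℝ) + x 1 • EuclideanSpace.single 1 (1 : ℝ) +
        x 2 • EuclideanSpace.single 2 (1 : ℝ)) := by rw [← hx]
      _ = _ := by simp only [map_add, map_smul]
  have h01 := hent 0 1
  have h12 := hent 1 2
  have h20 := hent 2 0
  ext i
  fin_cases i
  · rw [hexp]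
    simp [cross, cross_apply, hdiag, h01]
    ring
  · rw [hexp]
    simp [cross, cross_apply, hdiag, h12]
    ring
  · rw [hexp]
    simp [cross, cross_apply, hdiag, h20]
    ring

/-! ### Skew extension of a partially defined «skew» linear map -/

/-- **Skew extension.**  Let `Ω, β : W → ℝ³` be linear with `⟪Ω w, β w⟫ = 0` for all `w` and `β` constant on the fibres of `Ω`
(`ker Ω ≤ ker β`).  Then `β = M ∘ Ω` for a SKEW
linear map `M` of `ℝ³` (`⟪Mx, x⟫ = 0`): with `P` the orthogonal projection onto `V = range Ω` and `S = β ∘ Ω⁻¹ ∘ P` (any linear right inverse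
of `Ω : W → V`), `M = S − S^⊤ (1 − P)`. [folklore] -/
theorem exists_skew_extension {W : Type*} [AddCommMonoid W] [Module ℝ W]
    (Ω β : W →ₗ[ℝ] EuclideanSpace ℝ (Fin 3)) (hperp : ∀ w, ⟪Ω w, β w⟫ = 0)
    (hker : ∀ w w', Ω w = Ω w' → β w = β w') :
    ∃ M : EuclideanSpace ℝ (Fin 3) →L[ℝ] EuclideanSpace ℝ (Fin 3), (∀ x, ⟪M x, x⟫ = 0) ∧ ∀ w, M (Ω w) = β w := by
  set V : Submodule ℝ (EuclideanSpace ℝ (Fin 3)) := LinearMap.range Ω with hV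
  -- a linear right inverse of `Ω : W → V`
  obtain ⟨g, hg⟩ := Ω.rangeRestrict.exists_rightInverse_of_surjective Ω.range_rangeRestrict
  have hΩg : ∀ v : V, Ω (g v) = (v : EuclideanSpace ℝ (Fin 3)) := by
    intro v
    have h1 : Ω.rangeRestrict (g v) = v := by
      have := LinearMap.congr_fun hg v
      rwa [LinearMap.comp_apply, LinearMap.id_apply] at this
    exact congrArg Subtype.val h1
  -- `β ∘ g` is the factor map: `β (g (Ω w)) = β w`
  have hβg : ∀ w, β (g ⟨Ω w, LinearMap.mem_range_self Ω w⟩) = β w := by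
    intro w
    exact hker _ _ (hΩg ⟨Ω w, LinearMap.mem_range_self Ω w⟩)
  -- every `v ∈ V` is some `Ω w`, and then `⟪v, β (g v)⟫ = 0`
  have hVperp : ∀ v : V, ⟪(v : EuclideanSpace ℝ (Fin 3)), β (g v)⟫ = 0 := by
    intro v
    obtain ⟨w, hw⟩ := LinearMap.mem_range.1 v.2
    have hv : v = ⟨Ω w, LinearMap.mem_range_self Ω w⟩ := Subtype.ext hw.symm
    rw [hv, hβg]
    exact hperp w
  set P : EuclideanSpace ℝ (Fin 3) →L[ℝ] V := V.orthogonalProjectionOnto with hP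
  set S : EuclideanSpace ℝ (Fin 3) →ₗ[ℝ] EuclideanSpace ℝ (Fin 3) :=
    (β ∘ₗ g) ∘ₗ (P : EuclideanSpace ℝ (Fin 3) →ₗ[ℝ] V) with hS
  set M : EuclideanSpace ℝ (Fin 3) →ₗ[ℝ] EuclideanSpace ℝ (Fin 3) :=
    S - (LinearMap.adjoint S) ∘ₗ (LinearMap.id - (V.starProjection : EuclideanSpace ℝ (Fin 3) →ₗ[ℝ] EuclideanSpace ℝ (Fin 3)))
    with hM
  have hSx : ∀ x, S x = β (g (P x)) := fun x => rfl
  have hPx : ∀ x, ((P x : V) : EuclideanSpace ℝ (Fin 3)) = V.starProjection x := fun x => rfl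
  refine ⟨LinearMap.toContinuousLinearMap M, fun x => ?_, fun w => ?_⟩
  · show ⟪M x, x⟫ = 0
    have e1 : M x = S x - LinearMap.adjoint S (x - V.starProjection x) := by
      simp [hM]
    rw [e1, inner_sub_left, LinearMap.adjoint_inner_left, inner_sub_left, real_inner_comm (S x) x, ← hPx, hSx]
    have h0 := hVperp (P x)
    linarith
  · show M (Ω w) = β w
    have hmem : Ω w ∈ V := LinearMap.mem_range_self Ω w
    have e1 : M (Ω w) = S (Ω w) - LinearMap.adjoint S (Ω w - V.starProjection (Ω w)) := by
      simp [hM]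
    have e2 : V.starProjection (Ω w) = Ω w := Submodule.starProjection_eq_self_iff.2 hmem
    have e3 : P (Ω w) = ⟨Ω w, hmem⟩ := by
      apply Subtype.ext
      rw [hPx, e2]
    rw [e1, e2, sub_self, map_zero, sub_zero, hSx, e3, hβg]

/-! ### The common zero -/

/-- **A LINEAR FAMILY OF KILLING FIELDS OF `ℝ³` EACH OF WHICH HAS A ZERO HAS A COMMON ZERO.**  Let `W` be a linear subspace of
`(ℝ³ →L ℝ³) × ℝ³` such that for every `(B, b) ∈ W` the map `B` is skew (`⟪Bx, x⟫ = 0`) and `b ∈ range B` (i.e. the Killing field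
`x ↦ Bx − b` has a zero; for `B = 0` this forces `b = 0`: no translations).  Then there is ONE `p ∈ ℝ³` with `b = Bp` for ALL `(B, b) ∈ W`.
Proof: with the hat map `B = ω_B × ·` (linear in `B`), `b ∈ range B` gives `⟪ω_B, b⟫ = 0` and `ω_B = 0 ⇒ b = 0`; the skew extension gives a
skew `M` with `b = M ω_B = m × ω_B = ω_B × (−m) = B(−m)`. [folklore] -/
theorem exists_common_zero
    (W : Submodule ℝ ((EuclideanSpace ℝ (Fin 3) →L[ℝ] EuclideanSpace ℝ (Fin 3)) × EuclideanSpace ℝ (Fin 3)))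
    (hskew : ∀ κ ∈ W, ∀ x : EuclideanSpace ℝ (Fin 3), ⟪κ.1 x, x⟫ = 0)
    (hzero : ∀ κ ∈ W, ∃ q : EuclideanSpace ℝ (Fin 3), κ.2 = κ.1 q) :
    ∃ p : EuclideanSpace ℝ (Fin 3), ∀ κ ∈ W, κ.2 = κ.1 p := by
  -- the hat map (linear in the skew map), then restricted to `W`; and the translation part
  obtain ⟨L, hL⟩ : ∃ L : (EuclideanSpace ℝ (Fin 3) →L[ℝ] EuclideanSpace ℝ (Fin 3)) →ₗ[ℝ] EuclideanSpace ℝ (Fin 3),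
      ∀ B, L B = WithLp.toLp 2 ![B (EuclideanSpace.single 1 1) 2, B (EuclideanSpace.single 2 1) 0,
        B (EuclideanSpace.single 0 1) 1] := by
    refine ⟨{ toFun := fun B =>
                WithLp.toLp 2 ![B (EuclideanSpace.single 1 1) 2, B (EuclideanSpace.single 2 1) 0, B (EuclideanSpace.single 0 1) 1]
              map_add' := fun B B' => ?_
              map_smul' := fun c B => ?_ }, fun B => rfl⟩
    · ext i; fin_cases i <;> simp
    · ext i; fin_cases i <;> simp
  obtain ⟨Ω, hΩw'⟩ : ∃ Ω : W →ₗ[ℝ] EuclideanSpace ℝ (Fin 3),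
      ∀ w : W, Ω w = L (w : (EuclideanSpace ℝ (Fin 3) →L[ℝ] EuclideanSpace ℝ (Fin 3)) × EuclideanSpace ℝ (Fin 3)).1 :=
    ⟨(L ∘ₗ LinearMap.fst ℝ _ _) ∘ₗ W.subtype, fun w => rfl⟩
  obtain ⟨β, hβw⟩ : ∃ β : W →ₗ[ℝ] EuclideanSpace ℝ (Fin 3),
      ∀ w : W, β w = (w : (EuclideanSpace ℝ (Fin 3) →L[ℝ] EuclideanSpace ℝ (Fin 3)) × EuclideanSpace ℝ (Fin 3)).2 :=
    ⟨(LinearMap.snd ℝ _ _) ∘ₗ W.subtype, fun w => rfl⟩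
  have hΩw : ∀ w : W, ∀ x, (w : (EuclideanSpace ℝ (Fin 3) →L[ℝ] EuclideanSpace ℝ (Fin 3)) × EuclideanSpace ℝ (Fin 3)).1 x =
      cross (Ω w) x := fun w x => by
    rw [hΩw', hL]; exact skew_apply_eq_cross (hskew w w.2) x
  have hperp : ∀ w : W, ⟪Ω w, β w⟫ = 0 := by
    intro w
    obtain ⟨q, hq⟩ := hzero w w.2
    rw [hβw, hq, hΩw]
    simp [cross, cross_apply, PiLp.inner_apply, Fin.sum_univ_three]
    ring
  have hker : ∀ w w' : W, Ω w = Ω w' → β w = β w' := by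
    intro w w' hww
    -- the difference, formed in the ambient product space, lies in `W` and has zero axial vector
    have hmem : (w : (EuclideanSpace ℝ (Fin 3) →L[ℝ] EuclideanSpace ℝ (Fin 3)) × EuclideanSpace ℝ (Fin 3)) -
        (w' : (EuclideanSpace ℝ (Fin 3) →L[ℝ] EuclideanSpace ℝ (Fin 3)) × EuclideanSpace ℝ (Fin 3)) ∈ W :=
      W.sub_mem w.2 w'.2
    obtain ⟨q, hq⟩ := hzero _ hmem
    have hL0 : L ((w : (EuclideanSpace ℝ (Fin 3) →L[ℝ] EuclideanSpace ℝ (Fin 3)) × EuclideanSpace ℝ (Fin 3)).1 -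
        (w' : (EuclideanSpace ℝ (Fin 3) →L[ℝ] EuclideanSpace ℝ (Fin 3)) × EuclideanSpace ℝ (Fin 3)).1) = 0 := by
      rw [map_sub, ← hΩw', ← hΩw', hww, sub_self]
    have hB0 := skew_apply_eq_cross (hskew _ hmem) q
    have hc0 : cross (0 : EuclideanSpace ℝ (Fin 3)) q = 0 := by
      ext i; fin_cases i <;> simp [cross]
    rw [Prod.fst_sub, ← hL, hL0, hc0] at hB0
    rw [Prod.snd_sub, Prod.fst_sub, hB0] at hq
    rw [hβw, hβw]
    exact sub_eq_zero.1 hq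
  obtain ⟨M, hMskew, hM⟩ := exists_skew_extension Ω β hperp hker
  set m : EuclideanSpace ℝ (Fin 3) := WithLp.toLp 2 ![M (EuclideanSpace.single 1 1) 2, M (EuclideanSpace.single 2 1) 0,
    M (EuclideanSpace.single 0 1) 1] with hm
  have hMx : ∀ x, M x = cross m x := fun x => skew_apply_eq_cross hMskew x
  refine ⟨-m, fun κ hκ => ?_⟩
  have h1 := hM ⟨κ, hκ⟩
  rw [hβw] at h1
  have h2 := hΩw ⟨κ, hκ⟩ (-m)
  dsimp only at h1 h2
  rw [h2, ← h1, hMx, cross_eq_cross_neg_swap]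

end RigidFrame

end Summit.NavierStokesRegularity.NavierStokesRegularity.Theorems.PowerGaugeEulerLiouville

end
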